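import Literature.Probability.FitznerVanDerHofstad2017.NobleF3InitialPoint
import HarnessLib

/-!
# The non-backtracking two-point function at its critical point: `B_{1/(2d−1)}(x) = ρ_d · G(x)` (`d ≥ 3`), and the
harmonicity of the SRW Green function `G = I_{1,0}` at `λ = 1`

Topic `Literature/Probability/RandomPlanarGeometry` (Hara–Slade–Sokal loop-erasure lane; the inputs of the `(2̃,1)` row
of HSS93 Table 2).  The tree's `FitznerVanDerHofstad2017/NobleF3InitialPoint.lean` proves the threshold INEQUALITY
`Σ_n b_n(x)(2d−1)^{−n} ≤ ρ_d I_{1,0}(x)` (`tsum_nbwCountR_threshold_le`) by letting `z ↑ 1/(2d−1)` in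
`B_z = c(z) C_{λ(z)}` (`nbwGen_eq_coef_mul_green`).  Here the same limit gives the reverse inequality, hence the
EQUALITY — HSS93 (2.13)–(2.14) at `β = 1/(2d−1)`: `C₂(0,x; 1/(2d−1)) = ((2d−2)/(2d−1)) · C₀(0,x; 1/2d)` — which is what
turns the memory-2 linear systems (2.40)/(3.13)–(3.14) into systems over SRW Green-function values:

* `nbwLam_threshold`: `λ(1/(2d−1)) = 1`;
* `nbwGen_le_tsum_threshold`: `B_z(x) ≤ B_{1/(2d−1)}(x)` for `0 ≤ z < 1/(2d−1)`;
* `nbwRho_mul_sum_range_prob_le_tsum_threshold`: `ρ_d Σ_{m<M} p_m(x) ≤ B_{1/(2d−1)}(x)` (continuity in `z`);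
* **`tsum_nbwCountR_threshold_eq` / `nbwGen_threshold_eq` / `hasSum_nbwCountR_threshold`**:
  `Σ_n b_n(x)(2d−1)^{−n} = ρ_d I_{1,0}(x)` (`d ≥ 3`);
* **`srwI_one_renewal`**: `I_{1,0}(x) = δ₀(x) + (1/2d) Σ_v I_{1,0}(x − e_v)` (`d ≥ 3`; the renewal / harmonicity
  equation of the Green function at `λ = 1`, from `hasSum_prob_srwI_one` and `prob_succ_eq_sum_dir`), with the
  corollaries `srwI_one_zero_eq` (`G(0) = 1 + (1/2d) Σ_v G(−e_v)`) and `sum_dir_srwI_one_sub_eq`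
  (`Σ_v G(x − e_v) = 2d (G(x) − δ₀(x))`).

All statements are `d`-generic (`d ≥ 3` where a Green function is summed).  Used BY NAME from the tree: `nbwGen`,
`nbwCountR`, `nbwRho`, `nbwCoef`, `nbwLam`, `nbwDen_pos`, `nbwCoef_threshold`, `nbwGen_eq_coef_mul_green`,
`summable_nbwGen`, `summable_srwGreenKilled`, `summable_nbwCountR_threshold`, `tsum_nbwCountR_threshold_le`,
`hasSum_prob_srwI_one`, `prob_succ_eq_sum_dir`.  NOT CLAIMED: anything at `d ≤ 2`; rates of convergence; the Fourier
form `B̂ = c Ĉ`.  Label (proposed): PORT of HSS93 (2.13)–(2.14) at the threshold [equality, `d ≥ 3`] + folklore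
harmonicity of `G`.
-/

noncomputable section

namespace Literature.Probability.RandomPlanarGeometry.SAW.Zd.LoopErasure

open Finset Filter Topology
open scoped BigOperators
open Literature.Probability.LatticeModels
open Literature.Barriers.CriticalPhenomena
open Literature.Probability.FitznerVanDerHofstad2017

variable {d : ℕ}

/-! ### The killing rate at the threshold -/

/-- `λ(1/(2d−1)) = 2d(2d−1)^{−1}/(1 + (2d−1)^{−1}) = 1` (`d ≥ 1`).
[cite: HaraSladeSokal1993, §2.1 eq. (2.13)–(2.14) p. 6 (at β = 1/(2d−1) the SRW activity is 1/2d)] -/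
theorem nbwLam_threshold (hd : 1 ≤ d) : nbwLam d (1 / (2 * d - 1)) = 1 := by
  have hd' : (1 : ℝ) ≤ d := by exact_mod_cast hd
  have ha : (2 * d - 1 : ℝ) ≠ 0 := by linarith
  rw [nbwLam, div_eq_one_iff_eq (nbwDen_pos hd _).ne']
  field_simp
  ring

/-! ### Monotonicity in `z` up to the threshold -/

/-- `B_z(x) ≤ B_{1/(2d−1)}(x)` for `0 ≤ z`, `z(2d−1) < 1` (`d ≥ 3`; termwise `zⁿ ≤ (2d−1)^{−n}`, both series converge).
[cite: HaraSladeSokal1993, §2.1 eq. (2.13)–(2.14) p. 6] -/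
theorem nbwGen_le_tsum_threshold (hd : 3 ≤ d) {z : ℝ} (hz0 : 0 ≤ z) (hz : z * (2 * d - 1) < 1) (x : Site d) :
    nbwGen d z x ≤ ∑' n, (1 / (2 * d - 1) : ℝ) ^ n * nbwCountR d n x := by
  have hd1 : 1 ≤ d := by omega
  have hd' : (1 : ℝ) ≤ d := by exact_mod_cast hd1
  have ha : (0 : ℝ) < 2 * d - 1 := by linarith
  have hzle : z ≤ 1 / (2 * d - 1) := by
    rw [le_div_iff₀ ha]; exact hz.le
  unfold nbwGen
  exact Summable.tsum_le_tsum
    (fun n => mul_le_mul_of_nonneg_right (pow_le_pow_left₀ hz0 hzle n) (nbwCountR_nonneg n x))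
    (summable_nbwGen hd1 hz0 hz x) (summable_nbwCountR_threshold hd x)

/-! ### The lower bound at the threshold, by continuity in `z` -/

/-- **`ρ_d Σ_{m<M} p_m(x) ≤ B_{1/(2d−1)}(x)`** for every `M` (`d ≥ 3`): below the threshold
`c(z) Σ_{m<M} λ(z)^m p_m(x) ≤ c(z) C_{λ(z)}(x) = B_z(x) ≤ B_{1/(2d−1)}(x)`, and the left side is continuous in `z`
with value `ρ_d Σ_{m<M} p_m(x)` at `z = 1/(2d−1)` (`c → ρ_d`, `λ → 1`).
[cite: HaraSladeSokal1993, §2.1 eq. (2.13)–(2.14) p. 6] -/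
theorem nbwRho_mul_sum_range_prob_le_tsum_threshold (hd : 3 ≤ d) (M : ℕ) (x : Site d) :
    nbwRho d * ∑ m ∈ range M, SRW.prob d m x ≤ ∑' n, (1 / (2 * d - 1) : ℝ) ^ n * nbwCountR d n x := by
  have hd1 : 1 ≤ d := by omega
  have hd' : (1 : ℝ) ≤ d := by exact_mod_cast hd1
  have ha : (0 : ℝ) < 2 * d - 1 := by linarith
  set zI : ℝ := 1 / (2 * d - 1) with hzI
  have hzI0 : 0 < zI := by positivity
  set T : ℝ := ∑' n, zI ^ n * nbwCountR d n x with hT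
  -- the left side as a function of `z`
  set f : ℝ → ℝ := fun z => nbwCoef d z * ∑ m ∈ range M, nbwLam d z ^ m * SRW.prob d m x with hf
  have hlamc : Continuous (nbwLam d) := by
    refine Continuous.div (continuous_const.mul continuous_id)
      (continuous_const.add (continuous_const.mul (continuous_pow 2))) fun z => (nbwDen_pos hd1 z).ne'
  have hcoefc : Continuous (nbwCoef d) := by
    refine Continuous.div (continuous_const.sub (continuous_pow 2))
      (continuous_const.add (continuous_const.mul (continuous_pow 2))) fun z => (nbwDen_pos hd1 z).ne'
  have hfc : Continuous f :=
    hcoefc.mul (continuous_finsetSum _ fun m _ => (hlamc.pow m).mul continuous_const)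
  -- below the threshold `f z ≤ T`
  have hev : f ≤ᶠ[𝓝[<] zI] fun _ => T := by
    have hmem : Set.Ioi (0 : ℝ) ∩ Set.Iio zI ∈ 𝓝[<] zI :=
      Filter.inter_mem (mem_nhdsWithin_of_mem_nhds (Ioi_mem_nhds hzI0)) self_mem_nhdsWithin
    refine Filter.mem_of_superset hmem fun z hz => ?_
    obtain ⟨h0, h1⟩ := hz
    have h0' : 0 ≤ z := le_of_lt h0
    have hz' : z * (2 * d - 1) < 1 := by
      have : z < 1 / (2 * d - 1) := h1
      rwa [lt_div_iff₀ ha] at this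
    have hz1 : z ≤ 1 := by nlinarith
    have hl0 := nbwLam_nonneg hd1 h0'
    have hl1 := nbwLam_lt_one hd1 h0' hz'
    have hs := summable_srwGreenKilled hd1 hl0 hl1 x
    calc f z ≤ nbwCoef d z * srwGreenKilled d (nbwLam d z) x :=
          mul_le_mul_of_nonneg_left
            (hs.sum_le_tsum _ fun m _ => mul_nonneg (pow_nonneg hl0 m) (SRW.prob_nonneg _ _))
            (nbwCoef_nonneg hd1 h0' hz1)
      _ = nbwGen d z x := (nbwGen_eq_coef_mul_green hd1 h0' hz' x).symm
      _ ≤ T := nbwGen_le_tsum_threshold hd h0' hz' x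
  have hle : f zI ≤ T :=
    le_of_tendsto_of_tendsto ((hfc.tendsto zI).mono_left nhdsWithin_le_nhds)
      (tendsto_const_nhds.mono_left nhdsWithin_le_nhds) hev
  have hfI : f zI = nbwRho d * ∑ m ∈ range M, SRW.prob d m x := by
    simp only [hf, hzI, nbwCoef_threshold hd1, nbwLam_threshold hd1, one_pow, one_mul]
  rwa [hfI] at hle

/-- **`ρ_d I_{1,0}(x) ≤ B_{1/(2d−1)}(x)`** (`d ≥ 3`; `M → ∞` in the previous bound).
[cite: HaraSladeSokal1993, §2.1 eq. (2.13)–(2.14) p. 6] -/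
theorem nbwRho_mul_srwI_le_tsum_threshold (hd : 3 ≤ d) (x : Site d) :
    nbwRho d * srwI d 1 0 x ≤ ∑' n, (1 / (2 * d - 1) : ℝ) ^ n * nbwCountR d n x := by
  have hC := hasSum_prob_srwI_one hd x
  have ht : Tendsto (fun M => nbwRho d * ∑ m ∈ range M, SRW.prob d m x) atTop
      (𝓝 (nbwRho d * srwI d 1 0 x)) := hC.tendsto_sum_nat.const_mul _
  exact le_of_tendsto' ht fun M => nbwRho_mul_sum_range_prob_le_tsum_threshold hd M x

/-- **HSS93 (2.14) at the threshold / FvdH (1.21) as an equality**: `Σ_n b_n(x)(2d−1)^{−n} = ρ_d I_{1,0}(x)`,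
`ρ_d = (2d−2)/(2d−1)` (`d ≥ 3`).
[cite: HaraSladeSokal1993, §2.1 eq. (2.13)–(2.14) p. 6 (C₂(0,x;1/(2d−1)) = ((2d−2)/(2d−1)) C₀(0,x;1/2d))] -/
theorem tsum_nbwCountR_threshold_eq (hd : 3 ≤ d) (x : Site d) :
    ∑' n, (1 / (2 * d - 1) : ℝ) ^ n * nbwCountR d n x = nbwRho d * srwI d 1 0 x :=
  le_antisymm (tsum_nbwCountR_threshold_le hd x) (nbwRho_mul_srwI_le_tsum_threshold hd x)

/-- **`B_{1/(2d−1)}(x) = ρ_d G(x)`** with `G = I_{1,0}` the SRW Green function (`d ≥ 3`).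
[cite: HaraSladeSokal1993, §2.1 eq. (2.13)–(2.14) p. 6 (C₂(0,x;1/(2d−1)) = ((2d−2)/(2d−1)) C₀(0,x;1/2d))] -/
theorem nbwGen_threshold_eq (hd : 3 ≤ d) (x : Site d) :
    nbwGen d (1 / (2 * d - 1)) x = nbwRho d * srwI d 1 0 x :=
  tsum_nbwCountR_threshold_eq hd x

/-- The series form: `HasSum (n ↦ b_n(x)(2d−1)^{−n}) (ρ_d I_{1,0}(x))` (`d ≥ 3`).
[cite: HaraSladeSokal1993, §2.1 eq. (2.13)–(2.14) p. 6] -/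
theorem hasSum_nbwCountR_threshold (hd : 3 ≤ d) (x : Site d) :
    HasSum (fun n => (1 / (2 * d - 1) : ℝ) ^ n * nbwCountR d n x) (nbwRho d * srwI d 1 0 x) := by
  rw [← tsum_nbwCountR_threshold_eq hd x]
  exact (summable_nbwCountR_threshold hd x).hasSum

/-- Partial sums at the threshold are bounded by, and converge to, `ρ_d G(x)`:
`Σ_{n<N} b_n(x)(2d−1)^{−n} ≤ ρ_d I_{1,0}(x)` restated with the equality available (`d ≥ 3`).
[cite: HaraSladeSokal1993, §2.1 eq. (2.13)–(2.14) p. 6] -/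
theorem tendsto_sum_range_nbwCountR_threshold (hd : 3 ≤ d) (x : Site d) :
    Tendsto (fun N => ∑ n ∈ range N, (1 / (2 * d - 1) : ℝ) ^ n * nbwCountR d n x) atTop
      (𝓝 (nbwRho d * srwI d 1 0 x)) :=
  (hasSum_nbwCountR_threshold hd x).tendsto_sum_nat

/-! ### Harmonicity of the Green function at `λ = 1` -/

/-- **Renewal equation of the critical SRW Green function** (`d ≥ 3`):
`I_{1,0}(x) = δ₀(x) + (1/2d) Σ_v I_{1,0}(x − e_v)` — first-step decomposition `p_{n+1}(x) = (1/2d)Σ_v p_n(x − e_v)`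
summed over `n` (all series converge absolutely for `d ≥ 3`).
[cite: HaraSladeSokal1993, Appendix A.1 eq. (A.1)–(A.3) p. 27 (C₀(0,x;1/2d) = ∫dᵈk (2π)^{−d} e^{ik·x}/(1 − D̂(k)), i.e. C₀ = δ₀ + (1/2d)Σ_e C₀(· − e))] -/
theorem srwI_one_renewal (hd : 3 ≤ d) (x : Site d) :
    srwI d 1 0 x = SRW.prob d 0 x + 1 / (2 * d) * ∑ v : Fin d × Bool, srwI d 1 0 (x - SRW.stepVec v) := by
  have hs : ∀ y : Site d, Summable fun n => SRW.prob d n y := fun y => (hasSum_prob_srwI_one hd y).summable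
  have heq : ∀ y : Site d, srwI d 1 0 y = ∑' n, SRW.prob d n y := fun y =>
    (hasSum_prob_srwI_one hd y).tsum_eq.symm
  have T := (hs x).sum_add_tsum_nat_add 1
  simp only [Finset.sum_range_one] at T
  have h2 : ∑' n, SRW.prob d (n + 1) x = 1 / (2 * d) * ∑ v : Fin d × Bool, srwI d 1 0 (x - SRW.stepVec v) := by
    simp only [heq]
    rw [← Summable.tsum_finsetSum (fun v _ => hs (x - SRW.stepVec v)), ← tsum_mul_left]
    refine tsum_congr fun n => ?_
    rw [prob_succ_eq_sum_dir, Finset.mul_sum, Finset.sum_div]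
    exact Finset.sum_congr rfl fun v _ => by ring
  rw [heq x, ← T, h2]

/-- `G(0) = 1 + (1/2d) Σ_v G(−e_v)` (`d ≥ 3`). [cite: HaraSladeSokal1993, Appendix A.1 eq. (A.1)–(A.3) p. 27] -/
theorem srwI_one_zero_eq (hd : 3 ≤ d) :
    srwI d 1 0 (0 : Site d) = 1 + 1 / (2 * d) * ∑ v : Fin d × Bool, srwI d 1 0 (-SRW.stepVec v) := by
  have h := srwI_one_renewal hd (0 : Site d)
  simp only [SRW.prob_zero, zero_sub] at h
  exact h

/-- `Σ_v G(x − e_v) = 2d · (G(x) − δ₀(x))` (`d ≥ 3`). [cite: HaraSladeSokal1993, Appendix A.1 eq. (A.1)–(A.3) p. 27] -/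
theorem sum_dir_srwI_one_sub_eq (hd : 3 ≤ d) (x : Site d) :
    ∑ v : Fin d × Bool, srwI d 1 0 (x - SRW.stepVec v) = 2 * d * (srwI d 1 0 x - SRW.prob d 0 x) := by
  have hd0 : (0 : ℝ) < 2 * d := by
    have : (3 : ℝ) ≤ d := by exact_mod_cast hd
    linarith
  have h := srwI_one_renewal hd x
  field_simp at h
  linear_combination (-1 : ℝ) * h

end Literature.Probability.RandomPlanarGeometry.SAW.Zd.LoopErasure

end
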